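import Summits.AtomisticToContinuum.FouriersLaw.Theses.EmbeddedDrudeMourre

/-!
# FGRGap — load-bearing hypotheses, kill switch and normal forms (negative-side support)

Support lemmas for crux `EmbeddedDrudeMourre.FGRGap` (item stmt-AtomisticToContinuum-12595) from
the standing disprover's work file `Cruxes/FGRGap/Disproof.lean` §0–3, all sorry-free:

* kill switch: an odd `2π`-periodic measurable null vector of positive finite norm refutes
  `HasOddSectorGap` (`not_hasOddSectorGap_of_odd_null`, `…_of_odd_invariant`); contrapositive
  `cellNormSq_eq_zero_of_crux` (crux ⇒ no odd `L²` collisional invariant of positive norm);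
* each hypothesis dropped gives a false statement: periodicity (`k ↦ k` is an exact null vector),
  oddness (`1`), `0 < ω₂` as typed (`ω₂ ≤ -4`: junk band), both couplings (`Φ ≡ 0`):
  `hasOddSectorGap_false_without_periodic/odd`, `crux_false_without_omegaPos/couplings`;
* normal forms: `hasOddSectorGap_smul_iff` (only `b/a` and `ω₂` matter), `crux_iff_unit_onsite`.
-/

noncomputable section

open MeasureTheory Set Real
open scoped ENNReal
open Literature.MathematicalPhysics.KineticTheory.PhononBoltzmann

namespace Summit.AtomisticToContinuum.FouriersLaw.Theorems.FGRGap.Negative.LoadBearing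

/-- The crux unfolds to the typed family of form inequalities. -/
theorem crux_iff : Summit.AtomisticToContinuum.FouriersLaw.Theses.EmbeddedDrudeMourre.FGRGap ↔
    ∀ ω₂ a b : ℝ, 0 < ω₂ → 0 < a → 0 < b → HasOddSectorGap ω₂ a b := Iff.rfl

/-! ## 0. Basic measure-theoretic values on the Brillouin cell -/

/-- The Brillouin cell `(-π, π]` has Lebesgue measure `2π`. [folklore] -/
theorem volume_cell : volume (Ioc (-π) π) = ENNReal.ofReal (2 * π) := by
  rw [Real.volume_Ioc]; congr 1; ring

/-- `‖1‖² = 2π`. -/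
theorem cellNormSq_one : cellNormSq (fun _ => (1 : ℝ)) = ENNReal.ofReal (2 * π) := by
  unfold cellNormSq
  rw [setLIntegral_const, volume_cell]
  simp

/-- `0 < ‖k ↦ k‖²` (the non-periodic momentum function). -/
theorem cellNormSq_id_pos : 0 < cellNormSq (fun k => k) := by
  unfold cellNormSq
  have hsub : Ioc (π / 2) π ⊆ Ioc (-π) π := by
    intro k hk; exact ⟨by linarith [hk.1, Real.pi_pos], hk.2⟩
  have h1 : ∫⁻ k in Ioc (π / 2) π, ENNReal.ofReal ((π / 2) ^ 2) ≤
      ∫⁻ k in Ioc (π / 2) π, ENNReal.ofReal (k ^ 2) := by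
    apply setLIntegral_mono' measurableSet_Ioc
    intro k hk
    apply ENNReal.ofReal_le_ofReal
    have : 0 < π / 2 := by positivity
    nlinarith [hk.1]
  have h2 : ∫⁻ k in Ioc (π / 2) π, ENNReal.ofReal (k ^ 2) ≤
      ∫⁻ k in Ioc (-π) π, ENNReal.ofReal (k ^ 2) := lintegral_mono_set hsub
  rw [setLIntegral_const, Real.volume_Ioc] at h1
  have hpos : 0 < ENNReal.ofReal ((π / 2) ^ 2) * ENNReal.ofReal (π - π / 2) := by
    apply ENNReal.mul_pos
    · have : 0 < (π / 2) ^ 2 := by positivity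
      exact fun h0 => absurd (ENNReal.ofReal_eq_zero.mp h0) (not_le.mpr this)
    · have : 0 < π - π / 2 := by linarith [Real.pi_pos]
      exact fun h0 => absurd (ENNReal.ofReal_eq_zero.mp h0) (not_le.mpr this)
  exact lt_of_lt_of_le hpos (h1.trans h2)

/-- `‖k ↦ k‖² < ∞`. -/
theorem cellNormSq_id_lt_top : cellNormSq (fun k => k) < ∞ := by
  unfold cellNormSq
  have h1 : ∫⁻ k in Ioc (-π) π, ENNReal.ofReal (k ^ 2) ≤
      ∫⁻ _ in Ioc (-π) π, ENNReal.ofReal (π ^ 2) := by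
    apply setLIntegral_mono measurable_const
    intro k hk
    apply ENNReal.ofReal_le_ofReal
    nlinarith [hk.1, hk.2, Real.pi_pos]
  rw [setLIntegral_const] at h1
  exact lt_of_le_of_lt h1 (ENNReal.mul_lt_top ENNReal.ofReal_lt_top (by simp))

/-- `0 < ‖sin‖²` (Jordan's inequality on `(π/4, π/2]`). -/
theorem cellNormSq_sin_pos : 0 < cellNormSq Real.sin := by
  unfold cellNormSq
  have hsub : Ioc (π / 4) (π / 2) ⊆ Ioc (-π) π := by
    intro k hk; constructor <;> linarith [hk.1, hk.2, Real.pi_pos]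
  have h1 : ∫⁻ k in Ioc (π / 4) (π / 2), ENNReal.ofReal (1 / 4) ≤
      ∫⁻ k in Ioc (π / 4) (π / 2), ENNReal.ofReal (Real.sin k ^ 2) := by
    apply setLIntegral_mono' measurableSet_Ioc
    intro k hk
    apply ENNReal.ofReal_le_ofReal
    have hk0 : 0 ≤ k := by linarith [hk.1, Real.pi_pos]
    have hj := Real.mul_le_sin hk0 hk.2
    have hhalf : 1 / 2 ≤ 2 / π * k := by
      rw [div_mul_eq_mul_div, le_div_iff₀ Real.pi_pos]
      linarith [hk.1]
    nlinarith
  have h2 : ∫⁻ k in Ioc (π / 4) (π / 2), ENNReal.ofReal (Real.sin k ^ 2) ≤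
      ∫⁻ k in Ioc (-π) π, ENNReal.ofReal (Real.sin k ^ 2) := lintegral_mono_set hsub
  rw [setLIntegral_const, Real.volume_Ioc] at h1
  have hpos : 0 < ENNReal.ofReal (1 / 4) * ENNReal.ofReal (π / 2 - π / 4) := by
    apply ENNReal.mul_pos
    · simp
    · have : 0 < π / 2 - π / 4 := by linarith [Real.pi_pos]
      exact fun h0 => absurd (ENNReal.ofReal_eq_zero.mp h0) (not_le.mpr this)
  exact lt_of_lt_of_le hpos (h1.trans h2)

/-- `‖sin‖² < ∞`. -/
theorem cellNormSq_sin_lt_top : cellNormSq Real.sin < ∞ := by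
  unfold cellNormSq
  have h1 : ∫⁻ k in Ioc (-π) π, ENNReal.ofReal (Real.sin k ^ 2) ≤
      ∫⁻ _ in Ioc (-π) π, ENNReal.ofReal 1 := by
    apply setLIntegral_mono measurable_const
    intro k _
    apply ENNReal.ofReal_le_ofReal
    exact Real.sin_sq_le_one k
  rw [setLIntegral_const] at h1
  exact lt_of_le_of_lt h1 (ENNReal.mul_lt_top ENNReal.ofReal_lt_top (by simp))

/-! ## 1. The generic contradiction: a null vector of positive norm kills any gap constant -/

/-- If `q(f) = 0` while `0 < ‖f‖²`, no `g > 0` satisfies `g‖f‖² ≤ q(f)`. -/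
theorem no_gap_of_null {g : ℝ} (hg : 0 < g) {N q : ℝ≥0∞} (hN : 0 < N) (hq : q = 0)
    (h : ENNReal.ofReal g * N ≤ q) : False := by
  rw [hq] at h
  have h0 : ENNReal.ofReal g * N = 0 := le_antisymm h bot_le
  rcases mul_eq_zero.mp h0 with h1 | h1
  · exact (ENNReal.ofReal_pos.mpr hg).ne' h1
  · exact hN.ne' h1

/-- **Kill switch (kill criterion (b) of the route, formally).** An odd `2π`-periodic measurable
null vector of the form with `0 < ‖ψ‖² < ∞` refutes `HasOddSectorGap ω₂ a b`. -/
theorem not_hasOddSectorGap_of_odd_null {ω₂ a b : ℝ} {ψ : ℝ → ℝ}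
    (hper : Function.Periodic ψ (2 * π)) (hmeas : Measurable ψ) (hodd : Function.Odd ψ)
    (hpos : 0 < cellNormSq ψ) (hfin : cellNormSq ψ < ∞) (hq : boltzmannForm ω₂ a b ψ = 0) :
    ¬ HasOddSectorGap ω₂ a b := by
  rintro ⟨g, hg, h⟩
  exact no_gap_of_null hg hpos hq (h ψ hper hmeas hodd hfin)

/-- In particular an odd collisional invariant in `L²` of positive norm refutes the gap (for every
vertex), via `boltzmannForm_eq_zero_of_isCollisionalInvariant`. -/
theorem not_hasOddSectorGap_of_odd_invariant {ω₂ : ℝ} (a b : ℝ) {ψ : ℝ → ℝ}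
    (hψ : IsCollisionalInvariant ω₂ ψ) (hper : Function.Periodic ψ (2 * π)) (hmeas : Measurable ψ)
    (hodd : Function.Odd ψ) (hpos : 0 < cellNormSq ψ) (hfin : cellNormSq ψ < ∞) :
    ¬ HasOddSectorGap ω₂ a b :=
  not_hasOddSectorGap_of_odd_null hper hmeas hodd hpos hfin
    (boltzmannForm_eq_zero_of_isCollisionalInvariant a b hψ)

/-- Contrapositive, the form provers quote: **the crux implies that every odd `2π`-periodic
measurable `L²` collisional invariant of the pinned band has norm zero**, at every `ω₂ > 0`
(route KineticCorner's `NoOddCollisionalInvariant`, a.e. form). -/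
theorem cellNormSq_eq_zero_of_crux
    (h : Summit.AtomisticToContinuum.FouriersLaw.Theses.EmbeddedDrudeMourre.FGRGap)
    {ω₂ : ℝ} (hω : 0 < ω₂) {ψ : ℝ → ℝ} (hψ : IsCollisionalInvariant ω₂ ψ)
    (hper : Function.Periodic ψ (2 * π)) (hmeas : Measurable ψ) (hodd : Function.Odd ψ)
    (hfin : cellNormSq ψ < ∞) : cellNormSq ψ = 0 := by
  by_contra hne
  have hpos : 0 < cellNormSq ψ := pos_iff_ne_zero.mpr hne
  exact not_hasOddSectorGap_of_odd_invariant 1 1 hψ hper hmeas hodd hpos hfin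
    (h ω₂ 1 1 hω one_pos one_pos)

/-! ## 2. Load-bearing hypotheses: each one dropped gives a FALSE statement -/

/-- Crystal momentum `k ↦ k` (not a function on the torus) is an exact null vector of the typed
form: its bracket `k₁ + k₂ - k₃ - (k₁ + k₂ - k₃)` vanishes identically (momentum conservation is
built into the parametrisation; umklapp is invisible to a non-periodic `f`). -/
theorem boltzmannForm_id (ω₂ a b : ℝ) : boltzmannForm ω₂ a b (fun k => k) = 0 := by
  unfold boltzmannForm
  simp

/-- **Periodicity is load-bearing**: without it the odd `L²` function `k ↦ k` is a null vector,
for every `ω₂, a, b`. Any proof must use that `f` lives on the torus (umklapp). -/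
theorem hasOddSectorGap_false_without_periodic (ω₂ a b : ℝ) :
    ¬ ∃ g : ℝ, 0 < g ∧ ∀ f : ℝ → ℝ, Measurable f → Function.Odd f →
      cellNormSq f < ∞ → ENNReal.ofReal g * cellNormSq f ≤ boltzmannForm ω₂ a b f := by
  rintro ⟨g, hg, h⟩
  exact no_gap_of_null hg cellNormSq_id_pos (boltzmannForm_id ω₂ a b)
    (h (fun k => k) measurable_id (fun _ => rfl) cellNormSq_id_lt_top)

/-- `q(1) = 0` (phonon number). -/
theorem boltzmannForm_one (ω₂ a b : ℝ) : boltzmannForm ω₂ a b (fun _ => (1 : ℝ)) = 0 := by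
  simpa using boltzmannForm_const_add_mul_dispersion ω₂ a b 1 0

/-- **Oddness is load-bearing**: the even invariants `1, ω` are null vectors
(`boltzmannForm_const_add_mul_dispersion`); witness `1`. -/
theorem hasOddSectorGap_false_without_odd (ω₂ a b : ℝ) :
    ¬ ∃ g : ℝ, 0 < g ∧ ∀ f : ℝ → ℝ, Function.Periodic f (2 * π) → Measurable f →
      cellNormSq f < ∞ → ENNReal.ofReal g * cellNormSq f ≤ boltzmannForm ω₂ a b f := by
  rintro ⟨g, hg, h⟩
  have hpos : 0 < cellNormSq (fun _ => (1 : ℝ)) := by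
    rw [cellNormSq_one]; simpa using Real.pi_pos
  exact no_gap_of_null hg hpos (boltzmannForm_one ω₂ a b)
    (h (fun _ => 1) (fun _ => rfl) measurable_const (by rw [cellNormSq_one]; exact ENNReal.ofReal_lt_top))

/-- For `ω₂ ≤ -4` the typed band is the junk constant `0` (`Real.sqrt` of a non-positive number). -/
theorem dispersion_eq_zero_of_le {ω₂ : ℝ} (hω : ω₂ ≤ -4) (k : ℝ) : dispersion ω₂ k = 0 := by
  unfold dispersion
  apply Real.sqrt_eq_zero'.mpr
  have := Real.neg_one_le_cos k
  linarith

/-- … hence every collision weight is the junk `x / 0 = 0` … -/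
theorem collisionWeight_eq_zero_of_le {ω₂ : ℝ} (hω : ω₂ ≤ -4) (a b k₁ k₂ k₃ : ℝ) :
    collisionWeight ω₂ a b k₁ k₂ k₃ = 0 := by
  unfold collisionWeight
  simp [dispersion_eq_zero_of_le hω]

/-- … and the form vanishes identically. -/
theorem boltzmannForm_eq_zero_of_le {ω₂ : ℝ} (hω : ω₂ ≤ -4) (a b : ℝ) (f : ℝ → ℝ) :
    boltzmannForm ω₂ a b f = 0 := by
  unfold boltzmannForm
  simp [collisionWeight_eq_zero_of_le hω]

/-- `sin` is an admissible odd test function of positive finite norm; it refutes any gap claim for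
a form that vanishes identically. -/
theorem not_hasOddSectorGap_of_form_zero {ω₂ a b : ℝ}
    (h0 : ∀ f : ℝ → ℝ, boltzmannForm ω₂ a b f = 0) : ¬ HasOddSectorGap ω₂ a b :=
  not_hasOddSectorGap_of_odd_null Real.sin_periodic Real.measurable_sin (fun k => Real.sin_neg k)
    cellNormSq_sin_pos cellNormSq_sin_lt_top (h0 Real.sin)

/-- **`0 < ω₂` is load-bearing as typed** (junk regime, not physics): at `ω₂ = -4` the band,
the weights and the form are all `0`, so `HasOddSectorGap (-4) a b` fails for every vertex. The
physically meaningful boundary case `ω₂ = 0` (acoustic FPU-type band, no gap expected by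
Jäckle 1970 / LS08 Lemma 4.1 in THEIR normalisation) is not decided by this cheap argument: the
typed weight carries `(ω₁ω₂ω₃ω₄)⁻²`, which diverges at `k = 0` when `ω₂ = 0`. -/
theorem crux_false_without_omegaPos :
    ¬ ∀ ω₂ a b : ℝ, 0 < a → 0 < b → HasOddSectorGap ω₂ a b := fun h =>
  not_hasOddSectorGap_of_form_zero (boltzmannForm_eq_zero_of_le (le_refl (-4)) 1 1)
    (h (-4) 1 1 one_pos one_pos)

/-- Harmonic chain: the vertex `Φ_{0,0}` vanishes, so does every weight and the form. -/
theorem boltzmannForm_zero_zero (ω₂ : ℝ) (f : ℝ → ℝ) : boltzmannForm ω₂ 0 0 f = 0 := by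
  unfold boltzmannForm collisionWeight vertex
  simp

/-- **`(a, b) ≠ (0, 0)` is load-bearing**: the harmonic chain `a = b = 0` has `q ≡ 0`
(infinitely many odd conserved quantities; ballistic transport). Which of `0 < a`, `0 < b` is
really needed: numerically `0 < a` IS (the `a = 0` slice is gapless: odd bumps at `k = 0`, where
`Φ_{0,b} ∝ sin(k₁/2)` kills the grazing collision rate, have quotient `≍ ε² → 0`), `0 < b` is NOT
(`b = 0` is ALS's on-site model; `OnsiteReduction.onsite_of_crux`). -/
theorem crux_false_without_couplings :
    ¬ ∀ ω₂ a b : ℝ, 0 < ω₂ → HasOddSectorGap ω₂ a b := fun h =>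
  not_hasOddSectorGap_of_form_zero (boltzmannForm_zero_zero 1) (h 1 0 0 one_pos)

/-! ## 3. Normal forms of the crux (what a disproof may assume) -/

/-- Couplings scale out: `HasOddSectorGap ω₂ (εa) (εb) ↔ HasOddSectorGap ω₂ a b` for `ε ≠ 0`
(`q_{εa,εb} = ε² q_{a,b}`, `boltzmannForm_smul`). Only the ratio `b/a` and `ω₂` matter. -/
theorem hasOddSectorGap_smul_iff {ω₂ a b ε : ℝ} (hε : ε ≠ 0) :
    HasOddSectorGap ω₂ (ε * a) (ε * b) ↔ HasOddSectorGap ω₂ a b := by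
  have key : ∀ {a b ε : ℝ}, ε ≠ 0 → HasOddSectorGap ω₂ (ε * a) (ε * b) → HasOddSectorGap ω₂ a b := by
    intro a b ε hε ⟨g, hg, h⟩
    have hε2 : 0 < ε ^ 2 := by positivity
    refine ⟨g / ε ^ 2, div_pos hg hε2, fun f hper hmeas hodd hfin => ?_⟩
    have H := h f hper hmeas hodd hfin
    rw [boltzmannForm_smul] at H
    rw [ENNReal.ofReal_div_of_pos hε2, ENNReal.div_eq_inv_mul, mul_assoc]
    rw [ENNReal.inv_mul_le_iff (by simpa using hε2.ne') ENNReal.ofReal_ne_top]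
    exact H
  refine ⟨key hε, fun h => ?_⟩
  have h' : HasOddSectorGap ω₂ (ε⁻¹ * (ε * a)) (ε⁻¹ * (ε * b)) := by
    rwa [← mul_assoc, ← mul_assoc, inv_mul_cancel₀ hε, one_mul, one_mul]
  exact key (inv_ne_zero hε) h'

/-- **One-parameter normal form**: the crux is the statement for the vertex `Φ = 1 + 16 r ∏ sin`,
`r = b/a > 0`, at every `ω₂ > 0`. -/
theorem crux_iff_unit_onsite :
    Summit.AtomisticToContinuum.FouriersLaw.Theses.EmbeddedDrudeMourre.FGRGap ↔
      ∀ ω₂ r : ℝ, 0 < ω₂ → 0 < r → HasOddSectorGap ω₂ 1 r := by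
  constructor
  · intro h ω₂ r hω hr
    exact h ω₂ 1 r hω one_pos hr
  · intro h ω₂ a b hω ha hb
    have h1 := h ω₂ (b / a) hω (div_pos hb ha)
    have h2 := (hasOddSectorGap_smul_iff (ε := a) ha.ne').mpr h1
    rwa [mul_one, mul_div_cancel₀ _ ha.ne'] at h2


end Summit.AtomisticToContinuum.FouriersLaw.Theorems.FGRGap.Negative.LoadBearing

end
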